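import Literature.NumberTheory.Automorphic.DeligneSerreThm46bAllPairsProofs
import Literature.NumberTheory.Automorphic.ArtinLFunctionsRankOneMatching
import HarnessLib

/-!
# Deligne–Serre 1974, Thm. 4.6 (b) at the primes dividing the level: the discharge
`Literature.NumberTheory.Automorphic.deligneSerre_eulerFactorAt_eq_of_dvd_level_holds`
(pure proof; companion to `Literature.NumberTheory.Automorphic.LanglandsTunnellLSeriesProofs`,
`…DeligneSerreThm46bLeavesProofs` and `…DeligneSerreThm46bAllPairsProofs`)

Source: P. Deligne, J.-P. Serre, *Formes modulaires de poids 1*, Ann. Sci. ÉNS (4) 7 (1974),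
507–530, Thm. 4.6, p. 514: "Supposons `f` parabolique primitive … Soit `ρ` la représentation de
`G` correspondante.  Alors : (a) Le conducteur d'Artin de `ρ` est égal à `N`; (b) La fonction `L`
d'Artin de `ρ` est égale à `L(s, ρ) = Σ a_n n^{-s}`", with the proof (i)–(iv) of pp. 515–516:
(i) the functional equation of `f` (`f` primitive ⇒ `f |W_N = λ f̃`, Li, Miyake; Hecke's Mellin
transform), (ii) Artin's functional equation for `ρ` (odd by Rem. 4.5), (iii) the quotient of the
two completed L-functions is a finite Euler product `A^s ∏_{p ∣ N} F_p(p^{-s})` satisfying (★),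
(iv) Lemme 4.9 with `|a_p|, |b_p|, |c_p| ≤ 1` (1.8) forces `A = 1` and `F_p = 1` for all `p`.

The named fact `deligneSerre_eulerFactorAt_eq_of_dvd_level` (`LanglandsTunnellLSeriesProofs`) is
statement (b) read off at one prime `p ∣ N`: the Euler factor of `L(s, ρ)` at `p` is
`1 - a_p T`.  The tree reduced it to the two functional equations (i) and (ii)
(`deligneSerre_eulerFactorAt_eq_of_dvd_level_of_functionalEquations''`,
`DeligneSerreThm46bLeavesProofs`: steps (iii)–(iv), Lemme 4.9, the Hecke relations, Rem. 4.5
`rem45_isOdd_holds` and 1.8 `IsNewform1.cuspCoeff_of_dvd_level_holds` all being theorems), then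
to (ii) alone (`deligneSerre_eulerFactorAt_eq_of_dvd_level_of_artin_functional_equation`,
`DeligneSerreThm46bAllPairsProofs`, feeding (i) by
`DeligneSerre1974.weightOne_functionalEquation_holds`).  Input (ii),
`artin_functional_equation (K := ℚ)`, is now the theorem `artin_functional_equation_holds`
(`ArtinLFunctionsRankOneMatching`: Brauer's factorisation of the completed L-function with
Neukirch VII (11.7) (iii), and the degree-one case through Artin reciprocity, Hecke's
functional equation (8.6) for primitive ray class characters and an analytic matching of
conductors and `Γ`-factors, Neukirch VII (12.5)–(12.6)).  Hence the discharge below — a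
one-line composition; nothing else is declared here.

## References

* P. Deligne, J.-P. Serre, *Formes modulaires de poids 1*, Ann. Sci. École Norm. Sup. (4) 7
  (1974), 507–530, Thm. 4.6 (b) (p. 514) and its proof (i)–(iv), Lemme 4.9 (pp. 515–516).
  doi:10.24033/asens.1277 [DeligneSerreASENS1974]
* J. Neukirch, *Algebraic Number Theory*, Grundlehren 322, Springer 1999, Ch. VII Thm. (12.6).
  [NeukirchANT1999]
-/

noncomputable section

namespace Literature.NumberTheory.Automorphic

/-- **Deligne–Serre 1974, Thm. 4.6 (b) at `p ∣ N` holds** (the named fact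
`deligneSerre_eulerFactorAt_eq_of_dvd_level`: for a newform `f` of weight one and level `N` with
character `ε` and the continuous odd representation `ρ : G_ℚ → GL_2(ℂ)` attached to it, the Euler
factor of the Artin L-function `L(s, ρ)` at a prime `p ∣ N` is `1 - a_p T`, so that
`L(s, ρ) = Σ a_n n^{-s}` factor by factor).  The printed proof, steps (i)–(iv) of pp. 515–516:
`deligneSerre_eulerFactorAt_eq_of_dvd_level_of_artin_functional_equation` (steps (i), (iii), (iv)
with Rem. 4.5, 1.8 and Lemme 4.9, all theorems of the tree) applied to step (ii), Artin's
functional equation over `ℚ`, now the theorem `artin_functional_equation_holds`.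
[cite: DeligneSerreASENS1974, Thm. 4.6 (b), p. 514, and its proof (i)–(iv) with Lemme 4.9, pp. 515–516] -/
theorem deligneSerre_eulerFactorAt_eq_of_dvd_level_holds :
    deligneSerre_eulerFactorAt_eq_of_dvd_level :=
  deligneSerre_eulerFactorAt_eq_of_dvd_level_of_artin_functional_equation
    artin_functional_equation_holds

end Literature.NumberTheory.Automorphic

end
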